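import Summits.Ventures.LatticeQCDFlow.Scoring.SchwingerDysonLattice
import Literature.Analysis.FunctionSpaces.BesselIGeneratingFunction
import Literature.Algebra.EuclideanLattices.IntegerLatticeTheta
import Mathlib.MeasureTheory.Integral.Pi
import Mathlib.MeasureTheory.Integral.DominatedConvergence
import Mathlib.Algebra.BigOperators.GroupWithZero.Finset
import HarnessLib

/-!
# The character (Fourier) expansion of the finite-lattice U(1) Wilson integral

HONEST FRAMING: exact (Metropolis-corrected) sampling algorithms for lattice gauge theory;
figures of merit are autocorrelation/cost numbers at stated couplings and volumes; no
continuum-physics claim.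

Venture `LatticeQCDFlow` (cell pub-lqcd), sub-topic `Scoring`; FANOUT row 5 (`s0-sun-a`, whose
deliverable column includes the 'exact 2-d plaquette oracle (character expansion)'), GEN-7.  NEW
WORK of the cell (placement rule): the ABELIAN DUALITY / CHARACTER-EXPANSION FORMULA for the U(1)
Wilson weight of `Scoring/SchwingerDysonLattice.lean` — `n + 1` link angles on the torus box
`(0, 2π]^{n+1}`, a finite family of plaquettes `p : ι` with INTEGER incidences `inc p l` and
per-plaquette couplings `β_p`, `W(θ) = exp(Σ_p β_p cos θ_p)`, `θ_p = Σ_l inc p l · θ_l` — on ANY such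
finite complex (any dimension, any boundary condition, defects as `β_p`):

* §2 `ofReal_u1WilsonWeight_eq_tsum`: expanding every plaquette factor in the Fourier series
  `e^{β cos θ} = Σ_{k ∈ ℤ} I_{|k|}(β) e^{ikθ}` (the tree's `besselI`, DLMF 10.35;
  `Literature/Analysis/FunctionSpaces/BesselIGeneratingFunction.lean`) gives the absolutely
  convergent character sum `W(θ) = Σ_{m : ι → ℤ} ∏_p I_{|m_p|}(β_p) · e^{i Σ_l (Σ_p m_p inc p l) θ_l}`
  (`summable_norm_characterTerm`, `prod_characterTerm_eq`);
* §3 `integral_u1TorusBox_cexp_sum`: the link integrals are character orthogonality,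
  `∫_{(0,2π]^{n+1}} e^{i Σ_l a_l θ_l} dθ = (2π)^{n+1} [a = 0]` (`a : Fin (n+1) → ℤ`);
* §4 **`setIntegral_cexp_mul_u1WilsonWeight`** (the duality formula with a probe character
  `c : Fin (n+1) → ℤ`, term-by-term integration justified by `Σ_m ∏_p I_{|m_p|}(|β_p|) < ∞`):
  `∫_{(0,2π]^{n+1}} e^{i Σ_l c_l θ_l} W(θ) dθ
     = (2π)^{n+1} Σ_{m : ι → ℤ} [∀ l, c_l + Σ_p m_p inc p l = 0] ∏_p I_{|m_p|}(β_p)`,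
  and **`u1WilsonZ_univ_eq_tsum`**: the partition function `u1WilsonZ` is `(2π)^{n+1}` times the
  sum of `∏_p I_{|m_p|}(β_p)` over the integer plaquette assignments `m` with zero net charge on
  every link (`Σ_p m_p inc p l = 0`, the "flux conservation" / closed-surface condition of the
  dual model).

On a closed orientable two-dimensional complex the only such assignments are the constants, which
collapses the sum to `Σ_{k ∈ ℤ} ∏_p I_{|k|}(β_p)` — the finite-torus formula behind the cell's exact
2-d oracle (`ORACLE-u1-2d.json`, row 5 ORACLE-TABLE); that specialisation and the plaquette
expectation are the companion file `Scoring/U1TorusCharacterFormula.lean`.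

References (the classical statements we re-derive in the cell's own coordinates): R. Savit,
*Duality in field theory and statistical systems*, Rev. Mod. Phys. 52 (1980) §IV (abelian lattice
duality); J. M. Drouffe, J.-B. Zuber, *Strong coupling and mean field methods in lattice gauge
theories*, Phys. Rep. 102 (1983) §3 (character expansion).  What is NOT here: non-abelian groups
(Peter–Weyl), the infinite-volume limit, any numerical value.
-/

noncomputable section

open scoped Nat
open Real MeasureTheory Set Finset Literature.Analysis.FunctionSpaces

namespace Summit.Ventures.LatticeQCDFlow.Scoring

/-! ### 1. Products of absolutely convergent `ℤ`-series over a finite index type -/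

/-- **Fubini over `ℤ^ι`** for a finite index type `ι`: if every `Σ_k ‖F_p(k)‖` converges then
`m ↦ ∏_p F_p(m_p)` is absolutely summable over `ι → ℤ` and `Σ_m ∏_p F_p(m_p) = ∏_p Σ_k F_p(k)`
(transport of the tree's `Fin n` version `Literature.Algebra.EuclideanLattices.
summable_norm_prod_and_tsum_prod_eq` along `Fintype.equivFin`). -/
theorem summable_norm_prod_and_tsum_prod_eq_fintype {ι : Type*} [Fintype ι] (F : ι → ℤ → ℂ)
    (hF : ∀ p, Summable fun k => ‖F p k‖) :
    (Summable fun m : ι → ℤ => ‖∏ p, F p (m p)‖) ∧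
      ∑' m : ι → ℤ, ∏ p, F p (m p) = ∏ p, ∑' k, F p k := by
  classical
  set N := Fintype.card ι
  set e : ι ≃ Fin N := Fintype.equivFin ι
  obtain ⟨hS, hT⟩ := Literature.Algebra.EuclideanLattices.summable_norm_prod_and_tsum_prod_eq N
    (fun i k => F (e.symm i) k) fun i => hF (e.symm i)
  -- transport along `E m = m ∘ e.symm : (ι → ℤ) ≃ (Fin N → ℤ)`
  set E : (ι → ℤ) ≃ (Fin N → ℤ) := e.arrowCongr (Equiv.refl ℤ) with hE_def
  have hE : ∀ m : ι → ℤ, ∏ i, F (e.symm i) (E m i) = ∏ p, F p (m p) := fun m => by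
    simp only [hE_def, Equiv.arrowCongr_apply, Equiv.coe_refl, Function.comp_apply, id_eq]
    exact e.symm.prod_comp fun p => F p (m p)
  refine ⟨?_, ?_⟩
  · have h := (E.summable_iff (f := fun m' : Fin N → ℤ => ‖∏ i, F (e.symm i) (m' i)‖)).mpr hS
    exact h.congr fun m => by simp only [Function.comp_apply, hE]
  · rw [← e.symm.prod_comp fun p => ∑' k, F p k, ← hT,
      ← E.tsum_eq fun m' : Fin N → ℤ => ∏ i, F (e.symm i) (m' i)]
    exact tsum_congr fun m => (hE m).symm

/-! ### 2. The Wilson weight as an absolutely convergent character sum -/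

section Lattice

variable {n : ℕ} {ι : Type*} [Fintype ι] (inc : ι → Fin (n + 1) → ℤ) (βp : ι → ℝ)

/-- A continuous function with values in a normed group is integrable on the torus box. -/
theorem integrableOn_u1TorusBox' {m : ℕ} {E : Type*} [NormedAddCommGroup E] {f : (Fin m → ℝ) → E}
    (hf : Continuous f) : IntegrableOn f (u1TorusBox m) volume :=
  (hf.continuousOn.integrableOn_compact (isCompact_univ_pi fun _ => isCompact_Icc)).mono_set
    (Set.pi_mono fun _ _ => Set.Ioc_subset_Icc_self)

omit [Fintype ι] in
/-- **One plaquette factor expanded in characters**: `e^{β_p cos θ_p} = Σ_{k ∈ ℤ} I_{|k|}(β_p) e^{ikθ_p}`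
(the generating function of the modified Bessel functions at the plaquette angle). -/
theorem hasSum_plaquette_character (p : ι) (θ : Fin (n + 1) → ℝ) :
    HasSum (fun k : ℤ => (besselI k.natAbs (βp p) : ℂ) *
        Complex.exp ((k : ℂ) * u1PlaqAngle inc p θ * Complex.I))
      (Complex.exp ((βp p : ℂ) * Real.cos (u1PlaqAngle inc p θ))) :=
  hasSum_besselI_natAbs_mul_cexp _ _

/-- The Wilson weight as the product of the plaquette factors (complex form):
`W(θ) = ∏_p e^{β_p cos θ_p}`. -/
theorem ofReal_u1WilsonWeight_eq_prod (θ : Fin (n + 1) → ℝ) :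
    ((u1WilsonWeight univ inc βp θ : ℝ) : ℂ) =
      ∏ p, Complex.exp ((βp p : ℂ) * Real.cos (u1PlaqAngle inc p θ)) := by
  rw [u1WilsonWeight, Real.exp_sum, Complex.ofReal_prod]
  refine Finset.prod_congr rfl fun p _ => ?_
  rw [Complex.ofReal_exp]
  push_cast
  rfl

/-- **Absolute convergence of the character sum**: `Σ_{m : ι → ℤ} ‖∏_p I_{|m_p|}(β_p) e^{i m_p θ_p}‖ < ∞`
(it equals `∏_p e^{|β_p|}`). -/
theorem summable_norm_characterTerm (θ : Fin (n + 1) → ℝ) :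
    Summable fun m : ι → ℤ => ‖∏ p, (besselI (m p).natAbs (βp p) : ℂ) *
      Complex.exp (((m p : ℤ) : ℂ) * u1PlaqAngle inc p θ * Complex.I)‖ :=
  (summable_norm_prod_and_tsum_prod_eq_fintype
    (fun p k => (besselI k.natAbs (βp p) : ℂ) * Complex.exp ((k : ℂ) * u1PlaqAngle inc p θ * Complex.I))
    fun p => summable_norm_besselI_natAbs_mul_cexp (βp p) (u1PlaqAngle inc p θ)).1

/-- **The Wilson weight as a character sum**:
`W(θ) = Σ_{m : ι → ℤ} ∏_p I_{|m_p|}(β_p) e^{i m_p θ_p}`. -/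
theorem ofReal_u1WilsonWeight_eq_tsum (θ : Fin (n + 1) → ℝ) :
    ((u1WilsonWeight univ inc βp θ : ℝ) : ℂ) =
      ∑' m : ι → ℤ, ∏ p, (besselI (m p).natAbs (βp p) : ℂ) *
        Complex.exp (((m p : ℤ) : ℂ) * u1PlaqAngle inc p θ * Complex.I) := by
  rw [ofReal_u1WilsonWeight_eq_prod,
    (summable_norm_prod_and_tsum_prod_eq_fintype
      (fun p k => (besselI k.natAbs (βp p) : ℂ) *
        Complex.exp ((k : ℂ) * u1PlaqAngle inc p θ * Complex.I))
      fun p => summable_norm_besselI_natAbs_mul_cexp (βp p) (u1PlaqAngle inc p θ)).2]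
  exact Finset.prod_congr rfl fun p _ => ((hasSum_plaquette_character inc βp p θ).tsum_eq).symm

/-- The phases of one term collect link by link:
`∏_p I_{|m_p|}(β_p) e^{i m_p θ_p} = (∏_p I_{|m_p|}(β_p)) · e^{i Σ_l (Σ_p m_p inc p l) θ_l}`. -/
theorem prod_characterTerm_eq (m : ι → ℤ) (θ : Fin (n + 1) → ℝ) :
    ∏ p, (besselI (m p).natAbs (βp p) : ℂ) *
        Complex.exp (((m p : ℤ) : ℂ) * u1PlaqAngle inc p θ * Complex.I) =
      (∏ p, (besselI (m p).natAbs (βp p) : ℂ)) *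
        Complex.exp ((∑ l, ((∑ p, m p * inc p l : ℤ) : ℂ) * θ l) * Complex.I) := by
  rw [Finset.prod_mul_distrib, ← Complex.exp_sum, ← Finset.sum_mul]
  congr 3
  simp only [u1PlaqAngle, Complex.ofReal_sum, Complex.ofReal_mul, Complex.ofReal_intCast,
    Finset.mul_sum, Int.cast_sum, Int.cast_mul, Finset.sum_mul]
  rw [Finset.sum_comm]
  exact Finset.sum_congr rfl fun l _ => Finset.sum_congr rfl fun p _ => by ring

/-- The modulus of one term does not depend on the configuration:
`‖∏_p I_{|m_p|}(β_p) e^{i m_p θ_p}‖ = ‖∏_p I_{|m_p|}(β_p)‖`. -/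
theorem norm_prod_characterTerm (m : ι → ℤ) (θ : Fin (n + 1) → ℝ) :
    ‖∏ p, (besselI (m p).natAbs (βp p) : ℂ) *
        Complex.exp (((m p : ℤ) : ℂ) * u1PlaqAngle inc p θ * Complex.I)‖ =
      ‖∏ p, (besselI (m p).natAbs (βp p) : ℂ)‖ := by
  rw [norm_prod, norm_prod]
  refine Finset.prod_congr rfl fun p _ => ?_
  rw [norm_mul, show ((m p : ℤ) : ℂ) * u1PlaqAngle inc p θ * Complex.I =
    (((m p : ℝ) * u1PlaqAngle inc p θ : ℝ) : ℂ) * Complex.I by push_cast; ring,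
    Complex.norm_exp_ofReal_mul_I, mul_one]

/-- `m ↦ ‖∏_p I_{|m_p|}(β_p)‖` is summable over `ι → ℤ`. -/
theorem summable_norm_prod_besselI :
    Summable fun m : ι → ℤ => ‖∏ p, (besselI (m p).natAbs (βp p) : ℂ)‖ :=
  (summable_norm_prod_and_tsum_prod_eq_fintype (fun p k => (besselI k.natAbs (βp p) : ℂ))
    fun p => by
      simpa [Complex.norm_real, Real.norm_eq_abs, abs_besselI_eq_besselI_abs] using
        summable_besselI_natAbs |βp p|).1

/-! ### 3. Link integration: character orthogonality on the torus box -/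

/-- **Character orthogonality on `(0, 2π]^{n+1}`**: for integer link charges `a`,
`∫_{(0,2π]^{n+1}} e^{i Σ_l a_l θ_l} dθ = (2π)^{n+1}` if `a = 0` and `0` otherwise (Fubini over the
links, `∫₀^{2π} e^{iaθ} dθ = 2π [a = 0]`). -/
theorem integral_u1TorusBox_cexp_sum (a : Fin (n + 1) → ℤ) :
    ∫ θ in u1TorusBox (n + 1), Complex.exp ((∑ l, (a l : ℂ) * θ l) * Complex.I) =
      if (∀ l, a l = 0) then (2 * π : ℂ) ^ (n + 1) else 0 := by
  have hf : (fun θ : Fin (n + 1) → ℝ => Complex.exp ((∑ l, (a l : ℂ) * θ l) * Complex.I)) =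
      fun θ => ∏ l, Complex.exp ((a l : ℂ) * θ l * Complex.I) := by
    funext θ
    rw [Finset.sum_mul, Complex.exp_sum]
  have h1 : ∀ l, ∫ t in Set.Ioc 0 (2 * π), Complex.exp (((a l : ℤ) : ℂ) * t * Complex.I) =
      if a l = 0 then 2 * (π : ℂ) else 0 := fun l => by
    rw [← intervalIntegral.integral_of_le (by positivity : (0 : ℝ) ≤ 2 * π)]
    exact integral_cexp_int_mul (a l)
  have h2 := integral_fin_nat_prod_eq_prod (𝕜 := ℂ)
    (μ := fun _ : Fin (n + 1) => (volume : Measure ℝ).restrict (Set.Ioc 0 (2 * π)))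
    fun l t => Complex.exp (((a l : ℤ) : ℂ) * t * Complex.I)
  rw [hf, volume_restrict_u1TorusBox, h2]
  simp_rw [h1]
  by_cases h : ∀ l, a l = 0
  · rw [if_pos h, Finset.prod_congr rfl fun l _ => if_pos (h l), Finset.prod_const,
      Finset.card_univ, Fintype.card_fin]
  · rw [if_neg h]
    obtain ⟨l, hl⟩ := not_forall.mp h
    exact Finset.prod_eq_zero (Finset.mem_univ l) (if_neg hl)

/-- The torus box has finite volume. -/
theorem volume_u1TorusBox_ne_top (m : ℕ) : (volume : Measure (Fin m → ℝ)) (u1TorusBox m) ≠ ⊤ := by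
  rw [u1TorusBox, volume_pi_pi]
  exact ENNReal.prod_ne_top fun i _ => by rw [Real.volume_Ioc]; exact ENNReal.ofReal_ne_top

/-! ### 4. The character expansion of the lattice integral -/

/-- **The U(1) character expansion (abelian duality) with a probe character.**  For every finite
complex (`n + 1` links on the torus box, plaquettes `p : ι` with integer incidences `inc p l`,
couplings `β_p`) and every integer link charge `c`,
`∫_{(0,2π]^{n+1}} e^{i Σ_l c_l θ_l} exp(Σ_p β_p cos θ_p) dθ
   = (2π)^{n+1} Σ_{m : ι → ℤ} [∀ l, c_l + Σ_p m_p inc p l = 0] ∏_p I_{|m_p|}(β_p)`: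
expand each plaquette factor (§2), integrate the absolutely convergent sum term by term, and use
character orthogonality link by link (§3). -/
theorem setIntegral_cexp_mul_u1WilsonWeight [DecidableEq ι] (c : Fin (n + 1) → ℤ) :
    ∫ θ in u1TorusBox (n + 1), Complex.exp ((∑ l, (c l : ℂ) * θ l) * Complex.I) *
        ((u1WilsonWeight univ inc βp θ : ℝ) : ℂ) =
      (2 * π : ℂ) ^ (n + 1) * ∑' m : ι → ℤ,
        if (∀ l, c l + ∑ p, m p * inc p l = 0) then ∏ p, (besselI (m p).natAbs (βp p) : ℂ) else 0 := by
  -- the terms after collecting phases link by link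
  set G : (ι → ℤ) → (Fin (n + 1) → ℝ) → ℂ := fun m θ =>
    (∏ p, (besselI (m p).natAbs (βp p) : ℂ)) *
      Complex.exp ((∑ l, ((c l + ∑ p, m p * inc p l : ℤ) : ℂ) * θ l) * Complex.I) with hG
  -- pointwise expansion of the integrand
  have hpt : ∀ θ : Fin (n + 1) → ℝ,
      Complex.exp ((∑ l, (c l : ℂ) * θ l) * Complex.I) * ((u1WilsonWeight univ inc βp θ : ℝ) : ℂ) =
        ∑' m : ι → ℤ, G m θ := by
    intro θ
    rw [ofReal_u1WilsonWeight_eq_tsum, ← tsum_mul_left]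
    refine tsum_congr fun m => ?_
    rw [prod_characterTerm_eq, hG, mul_left_comm, ← Complex.exp_add, ← add_mul,
      ← Finset.sum_add_distrib]
    congr 3
    refine Finset.sum_congr rfl fun l _ => ?_
    push_cast
    ring
  have hGcont : ∀ m, Continuous (G m) := fun m => by
    simp only [hG]
    fun_prop
  have hGint : ∀ m, Integrable (G m) ((volume : Measure (Fin (n + 1) → ℝ)).restrict
      (u1TorusBox (n + 1))) := fun m => integrableOn_u1TorusBox' (hGcont m)
  have hGnorm : ∀ m θ, ‖G m θ‖ = ‖∏ p, (besselI (m p).natAbs (βp p) : ℂ)‖ := by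
    intro m θ
    rw [hG, norm_mul, show (∑ l, ((c l + ∑ p, m p * inc p l : ℤ) : ℂ) * θ l) * Complex.I =
      ((∑ l, ((c l + ∑ p, m p * inc p l : ℤ) : ℝ) * θ l : ℝ) : ℂ) * Complex.I by push_cast; ring,
      Complex.norm_exp_ofReal_mul_I, mul_one]
  have hGsum : Summable fun m => ∫ θ in u1TorusBox (n + 1), ‖G m θ‖ := by
    simp_rw [hGnorm, setIntegral_const]
    exact (summable_norm_prod_besselI βp).const_smul _
  have hfun : (fun θ : Fin (n + 1) → ℝ =>
      Complex.exp ((∑ l, (c l : ℂ) * θ l) * Complex.I) * ((u1WilsonWeight univ inc βp θ : ℝ) : ℂ)) =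
        fun θ => ∑' m : ι → ℤ, G m θ := funext hpt
  rw [hfun, ← integral_tsum_of_summable_integral_norm hGint hGsum, ← tsum_mul_left]
  refine tsum_congr fun m => ?_
  have h3 := integral_u1TorusBox_cexp_sum fun l => c l + ∑ p, m p * inc p l
  rw [hG]
  simp only at h3 ⊢
  rw [MeasureTheory.integral_const_mul, h3]
  split_ifs <;> ring

/-- **The U(1) partition function by characters (complex form)**:
`Z = ∫_{(0,2π]^{n+1}} exp(Σ_p β_p cos θ_p) dθ = (2π)^{n+1} Σ_{m : ι → ℤ} [∀ l, Σ_p m_p inc p l = 0] ∏_p I_{|m_p|}(β_p)`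
— the sum runs over the integer plaquette assignments with zero net charge on every link. -/
theorem ofReal_u1WilsonZ_univ_eq_tsum [DecidableEq ι] :
    ((u1WilsonZ univ inc βp : ℝ) : ℂ) = (2 * π : ℂ) ^ (n + 1) * ∑' m : ι → ℤ,
        if (∀ l, ∑ p, m p * inc p l = 0) then ∏ p, (besselI (m p).natAbs (βp p) : ℂ) else 0 := by
  have h := setIntegral_cexp_mul_u1WilsonWeight inc βp 0
  simp only [Pi.zero_apply, Int.cast_zero, zero_mul, Finset.sum_const_zero, Complex.exp_zero,
    one_mul, zero_add] at h
  rw [u1WilsonZ, ← integral_complex_ofReal, h]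

/-- **The U(1) partition function by characters (real form)**:
`u1WilsonZ = (2π)^{n+1} Σ_{m : ι → ℤ} [∀ l, Σ_p m_p inc p l = 0] ∏_p I_{|m_p|}(β_p)`. -/
theorem u1WilsonZ_univ_eq_tsum [DecidableEq ι] :
    u1WilsonZ univ inc βp = (2 * π) ^ (n + 1) * ∑' m : ι → ℤ,
        if (∀ l, ∑ p, m p * inc p l = 0) then ∏ p, besselI (m p).natAbs (βp p) else 0 := by
  apply Complex.ofReal_injective
  rw [ofReal_u1WilsonZ_univ_eq_tsum]
  push_cast
  congr 1
  refine tsum_congr fun m => ?_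
  split_ifs <;> simp

end Lattice

end Summit.Ventures.LatticeQCDFlow.Scoring
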